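import Summits.QuantumFields.YangMills.Theorems.IR.AfPincerUcSupplier
import Summits.QuantumFields.YangMills.Theorems.IR.AfPincerUcFormat
import HarnessLib

/-!
# Line `af-pincer-Uc` (crux `IR`, stmt-QuantumFields-19354): the reduction of the REGISTERED statement
# `AfPincerUc.OnsetMixingTypicalUKPc` (`stub_onsetUc`) to «clause (i) + single-cell rarity» in the slot's own names

Helper module for item `stmt-QuantumFields-19354` (`--supports`; it closes nothing); lead prover of the line.  Slot of record
«af-pincer-Uc» re-based on the tree format module `Theorems/IR/AfPincerUcFormat` (owner R81, sha16 7eb42365f8aba369).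
The tree reduction `AfPincerUc.Supplier.onsetMixingTypicalUKPc_of_clauseI_supCellRarity` concludes the disprover's mirror
`OnsetFormatsUc.OnsetMixingTypicalUKPc`; S1's bridge `AfPincerUc.onsetMixingTypicalUKPc_iff_mirror` (`Iff.rfl` up to the
aliasing) carries it to the stub's statement BY NAME.  This file imports the (route-tied) format module on purpose: the
stub's statement lives there.

* `onsetMixingTypicalUKPc_of_clauseI_supCellRarity'` : `ClauseIAndRarityAtOnset → AfPincerUc.OnsetMixingTypicalUKPc`;
* `ClauseIWorkingClassAtOnset` — the working-class form of the remaining obligation: admissible `(n, ε)`; for every `δ > 0`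
  and all large `β` SOME mesh `b ≥ 1` and parameters `(ℓ, T, Rs, E)` with, on every mesh-`b` frame, (b) clause (i) at the
  centre for `WorkingClass r.ρ ℓ T Rs E w` and (a) its any-exterior single-cell rarity `δ` ((a) is the explicit inequality
  `workingBudget ≤ δ` by `supCellRarityAt_workingClass_explicit` of `Theorems/BalabanLadderIRWorkingClassBudget`);
* `onsetMixingTypicalUKPc_of_workingClass'` : `ClauseIWorkingClassAtOnset → AfPincerUc.OnsetMixingTypicalUKPc`.

HONEST FRAMING: (b) — sub-region mixing of the Yang–Mills kernel at the centre cell at a β-dependent mesh `b(β) → ∞`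
(bounded mesh refuted in kernel), uniformly over typical frozen data — is the stub's research content (weak-coupling strong
mixing of 4-d non-abelian lattice gauge theory beyond the correlation length) and is NOT claimed.  Conditional chain above the
crux untouched; not a gap, not Clay.  No `sorry`; axioms ⊆ {propext, Classical.choice, Quot.sound}.
-/

set_option autoImplicit false

noncomputable section

open Literature.MathematicalPhysics.QuantumFieldTheory Literature.MathematicalPhysics.QuantumLattice
open Summit.QuantumFields.YangMills.Cruxes.IR.FixedMesh (ClauseI)
open Summit.QuantumFields.YangMills.Cruxes.IR.OnsetFormatsUc (IsFrame)
open Summit.QuantumFields.YangMills.Theorems.IRTypLocalExcess (WorkingClass)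

namespace Summit.QuantumFields.YangMills.Cruxes.IR.AfPincerUc.Supplier

/-! ## §4 The reduction of record in the slot's own names -/

/-- **REDUCTION OF RECORD for the registered stub, in the slot's names:**
`ClauseIAndRarityAtOnset → AfPincerUc.OnsetMixingTypicalUKPc` (S1's `onsetMixingTypicalUKPc_iff_mirror` after the tree
reduction `onsetMixingTypicalUKPc_of_clauseI_supCellRarity`). -/
theorem onsetMixingTypicalUKPc_of_clauseI_supCellRarity' (h : ClauseIAndRarityAtOnset) :
    Summit.QuantumFields.YangMills.Cruxes.IR.AfPincerUc.OnsetMixingTypicalUKPc :=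
  onsetMixingTypicalUKPc_iff_mirror.mpr (onsetMixingTypicalUKPc_of_clauseI_supCellRarity h)

/-- **«Clause (i) for the working class at a β-dependent mesh, with its rarity budget met»** — what `stub_onsetUc` reduces
to: for every compact simple `G` and lattice representation `r`, admissible `(n, ε)` and, for every `δ > 0` and all large
`β`, SOME mesh `b ≥ 1` and parameters `(ℓ, T, Rs, E)` such that on every mesh-`b` frame the working class
`diluteTyp ∩ Typ_lx^int` (a) has any-exterior single-cell rarity `δ` (dischargeable by `supCellRarityAt_workingClass_explicit`:
an explicit inequality `workingBudget ≤ δ`) and (b) satisfies clause (i) at the centre (`FixedMesh.ClauseI`, = the slot's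
`AfPincerUc.ClauseI`).  (b) is the research content. -/
def ClauseIWorkingClassAtOnset : Prop :=
  ∀ (G : Type) [Group G] [TopologicalSpace G] [IsTopologicalGroup G] [CompactSpace G],
    IsCompactSimpleLieGroup G → letI : MeasurableSpace G := borel G; haveI : BorelSpace G := ⟨rfl⟩;
    ∀ r : LatticeRep G, ∃ (n : ℕ) (ε : ℝ), 1 ≤ n ∧ 0 ≤ ε ∧ ε * OnsetFormats.shellCount n ≤ 3 / 4 ∧
      ∀ δ : ℝ, 0 < δ → ∃ β₂ : ℝ, ∀ β : ℝ, β₂ ≤ β → ∃ b : ℕ, 1 ≤ b ∧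
        ∃ (ℓ : ℕ) (T : ℝ) (Rs : Set ℕ) (E : ℕ → ℝ), ∀ w : Fin 4 → ℤ → ℤ, IsFrame b w →
          ClauseI r.ρ β w n ε (WorkingClass r.ρ ℓ T Rs E w) ∧
            SupCellRarityAt r.ρ β w (WorkingClass r.ρ ℓ T Rs E w) δ

/-- **`ClauseIWorkingClassAtOnset → AfPincerUc.OnsetMixingTypicalUKPc`** (the registered stub's statement BY NAME). -/
theorem onsetMixingTypicalUKPc_of_workingClass' (h : ClauseIWorkingClassAtOnset) :
    Summit.QuantumFields.YangMills.Cruxes.IR.AfPincerUc.OnsetMixingTypicalUKPc :=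
  onsetMixingTypicalUKPc_iff_mirror.mpr (onsetMixingTypicalUKPc_of_workingClass h)

end Summit.QuantumFields.YangMills.Cruxes.IR.AfPincerUc.Supplier

end
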